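import Literature.Topology.FourManifolds.HomotopySpheres
import HarnessLib

/-!
# Named fact: every homotopy 4-sphere is h-cobordant to `S⁴` (`Θ₄ = 0` in Kervaire–Milnor's sense)

Topic `Literature/Topology/FourManifolds`; cite item `wi-03818` (route
SmoothPoincare4/Stabilisation), over the tree's `Literature.HomotopySphere 4` (`HomotopySpheres.lean`) and
`Literature.Topology.FourManifolds.IsHCobordant` (`Cobordism.lean`, unoriented h-cobordism of closed manifolds).

**Kervaire–Milnor 1963, table of orders of `Θₙ` on p. 504 (entry `n = 4 ↦ 1`: `Θ₄ = 0`); Wall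
1964.** Kervaire–Milnor's `Θₙ` is the group of homotopy `n`-spheres modulo h-COBORDISM (Thm. 1.1,
p. 504, is the statement that these classes form an abelian group under connected sum); `Θ₄ = 0`
says that every homotopy 4-sphere `Σ` is h-cobordant to `S⁴` (equivalently bounds a contractible
smooth 5-manifold: `Σ` is spin with signature `0`, so it bounds; surgery on the bounding manifold
makes it contractible). In the paper this is proved inside Part I: every homotopy sphere is
s-parallelizable (Thm. 3.1, p. 508); `Θₙ / bPₙ₊₁ ↪ Πₙ / p(Sⁿ)` with the table of these cokernels
for `n ≤ 8` (§4, p. 512), so `Θ₄ = bP₅`; a homotopy `2k`-sphere bounding an s-parallelizable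
manifold bounds a contractible one (Thm. 5.1, p. 512, here `k = 2`: `bP₅ = 0`); and a simply
connected closed manifold bounding a contractible manifold is h-cobordant to `Sⁿ` (Lemma 2.3,
p. 506). The tree decomposes the fact along exactly this chain in `ThetaFourKervaireMilnor.lean`.
This is NOT the smooth Poincaré conjecture in dimension 4 (the h-cobordism need not be a product;
cf. `HCobordism.lean`, "Deliberately not stated"). Nothing asserted.

## References

* M. Kervaire, J. Milnor, *Groups of homotopy spheres I*, Ann. of Math. 77 (1963) 504–537,
  table p. 504, Lemma 2.3 (p. 506), Thm. 3.1 (p. 508), §4 (p. 512), Thm. 5.1 (p. 512).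
* C. T. C. Wall, *On simply-connected 4-manifolds*, J. London Math. Soc. 39 (1964) 141–149,
  Thms. 2–3.
-/

noncomputable section

open scoped Manifold ContDiff

namespace Literature.Topology.FourManifolds

/-- NAMED FACT (**Kervaire–Milnor 1963, `Θ₄ = 0` (h-cobordism classes): table of orders of `Θₙ`,
p. 504, entry `n = 4 ↦ 1`**, proved in Part I from Thm. 3.1 (p. 508), §4 (p. 512:
`Θₙ / bPₙ₊₁ ↪ Πₙ / p(Sⁿ)`), Thm. 5.1 (p. 512: `bP₅ = 0`) and Lemma 2.3 (p. 506); Thm. 1.1 (p. 504)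
is only the group structure; Wall 1964): every (oriented) homotopy 4-sphere is smoothly h-cobordant
to the standard `S⁴`. Users take `(h : isHCobordant_sphere_of_homotopySphere_four)`.
[Kervaire–Milnor 1963, table p. 504 with Thm. 3.1, §4, Thm. 5.1, Lemma 2.3; Wall 1964, Thms. 2–3] [cite: KervaireMilnorAnnals1963, table p. 504 (Θ₄ = 0) via Thm. 5.1, §4 (p. 512) and Lemma 2.3 (p. 506)] -/
def isHCobordant_sphere_of_homotopySphere_four : Prop :=
  ∀ S : HomotopySphere 4,
    IsHCobordant 4 S.carrier (Metric.sphere (0 : EuclideanSpace ℝ (Fin 5)) 1)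

/-- Consequently any two homotopy 4-spheres are h-cobordant to each other, GIVEN transitivity and
symmetry of h-cobordism (the tree's `IsHCobordant.trans` is itself a named fact; symmetry is
proved). [Kervaire–Milnor 1963, §1–2] [folklore] -/
theorem HomotopySphere.isHCobordant_of_theta_four (h : isHCobordant_sphere_of_homotopySphere_four)
    (S T : HomotopySphere 4)
    (htrans : IsHCobordant.trans (n := 4) (M := S.carrier)
      (N := Metric.sphere (0 : EuclideanSpace ℝ (Fin 5)) 1) (P := T.carrier)) :
    S.IsHCobordant T :=
  htrans (h S) (h T).symm

end Literature.Topology.FourManifolds
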